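import Summits.Ventures.PercRepro.C026MarkCalculus
import Summits.Ventures.PercRepro.C026ThetaHub

/-!
# A unicyclic instance through the mark calculus: the ten-edge sun (p6, gen 12)

`sunTen` is a 4-cycle `6 7 8 9` with the three marks hanging off three of its vertices by paths of
lengths `2`, `1`, `3`: `0–3–6`, `1–7`, `2–4–5–8` — ten vertices, ten edges, one cycle, the marks in
three different branches.  No landed family covers it (the cycle is inside the single
`{0, 1, 2}`-bridge; it is neither acyclic, nor hub-pair, nor a star gadget, and after the series
steps its core is the net).  The mark calculus settles it at every edge weight:

* four series steps at the non-marks `5, 4, 3, 9` (`sunTen_reduces`) leave the net `0–6, 1–7, 2–8`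
  + triangle `6 7 8` live;
* the pendant-mark step moves `2` to `8` (`PendantOn 2 8 3`);
* the live support is then `{0, 1, 6, 7, 8}` — five vertices — and `MInst.C026_of_reduces_five`
  closes (`C026At_sunTen`).

This is the shape of every instance of Theorem U (`proofs/P6-unicyclic.md`): at most one cycle ⇒
series / pendant / parallel steps to a cycle with ≤ 3 pendant marks ⇒ the pendant-mark step ⇒
five vertices.
-/

namespace PercRepro

namespace MultiGraph

/-- `PendantOn` is decidable on finite types. -/
instance decidablePendantOnFin {V E : Type} [DecidableEq V] [DecidableEq E] [Fintype E]
    (G : MultiGraph V E) (c w : V) (f : E) : Decidable (G.PendantOn c w f) :=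
  decidable_of_iff
    (((∀ e, (G.fst e = c ∨ G.snd e = c) → (G.fst e = c ∧ G.snd e = w) ∨ (G.fst e = w ∧ G.snd e = c)) ∧
        ∃ e, G.fst e = c ∨ G.snd e = c) ∧
      ∀ e, (G.fst e = c ∨ G.snd e = c) → e = f)
    ⟨fun ⟨⟨h1, h2⟩, h3⟩ => ⟨⟨h1, h2⟩, h3⟩, fun ⟨⟨h1, h2⟩, h3⟩ => ⟨⟨h1, h2⟩, h3⟩⟩

/-- **The ten-edge sun**: the cycle `6–7–8–9–6` (edges `6, 7, 8, 9`) with the pendant paths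
`0–3–6` (edges `0, 1`), `1–7` (edge `2`) and `2–4–5–8` (edges `3, 4, 5`); marks `0, 1, 2`. -/
def sunTen : MultiGraph (Fin 10) (Fin 10) where
  fst := ![0, 3, 1, 2, 4, 5, 6, 7, 8, 9]
  snd := ![3, 6, 7, 4, 5, 8, 7, 8, 9, 6]

/-- After the four series steps: edge `4` re-attached to `4–8`, `3` to `2–8`, `0` to `0–6`,
`8` to `8–6`. -/
def sunTen.reduced : MultiGraph (Fin 10) (Fin 10) :=
  (((sunTen.seriesGraph 4 4 8).seriesGraph 3 2 8).seriesGraph 0 0 6).seriesGraph 8 8 6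

/-- The weight after the chain: series at `5`, `4`, `3`, `9`, then the pendant mark `2` moved to
`8` (its edge `3` killed). -/
noncomputable def sunTen.reducedWeight (p : Fin 10 → ℝ) : Fin 10 → ℝ :=
  Function.update (serWeight (serWeight (serWeight (serWeight p 4 5) 3 4) 0 1) 8 9) 3 0

/-- **The chain**: series at `5` (`4, 5`), at `4` (`3, 4`), at `3` (`0, 1`), at `9` (`8, 9`), then
the pendant mark `2 → 8`. -/
theorem sunTen_reduces (p : Fin 10 → ℝ) :
    MReduces ((sunTen, p), ((0 : Fin 10), (1 : Fin 10), (2 : Fin 10)))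
      ((sunTen.reduced, sunTen.reducedWeight p), ((0 : Fin 10), (1 : Fin 10), (8 : Fin 10))) := by
  unfold MReduces
  refine Relation.ReflTransGen.head (MStep.sp
    (SPStep3.series (e₁ := 4) (e₂ := 5) (x := 5) (y := 4) (z := 8) (by decide) (by decide))) ?_
  refine Relation.ReflTransGen.head (MStep.sp
    (SPStep3.series (e₁ := 3) (e₂ := 4) (x := 4) (y := 2) (z := 8) (by decide) (by decide))) ?_
  refine Relation.ReflTransGen.head (MStep.sp
    (SPStep3.series (e₁ := 0) (e₂ := 1) (x := 3) (y := 0) (z := 6) (by decide) (by decide))) ?_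
  refine Relation.ReflTransGen.head (MStep.sp
    (SPStep3.series (e₁ := 8) (e₂ := 9) (x := 9) (y := 8) (z := 6) (by decide) (by decide))) ?_
  refine Relation.ReflTransGen.head
    (MStep.pendantMark (c := 2) (w := 8) (f := 3) (by decide) (by decide) (by decide) (by decide)) ?_
  exact Relation.ReflTransGen.refl

/-- The dead edges after the chain. -/
def sunTen.dead : Finset (Fin 10) := {1, 3, 4, 5, 9}

/-- The edges `1, 3, 4, 5, 9` are dead after the chain. -/
theorem sunTen.reducedWeight_dead (p : Fin 10 → ℝ) :
    ∀ e ∈ sunTen.dead, sunTen.reducedWeight p e = 0 := by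
  intro e he
  unfold sunTen.reducedWeight serWeight
  simp only [sunTen.dead, Finset.mem_insert, Finset.mem_singleton] at he
  rcases he with rfl | rfl | rfl | rfl | rfl <;> simp

/-- The vertex map folding the isolated vertices away: the live support `{0, 1, 6, 7, 8}`. -/
def sunTen.fold : Fin 10 → Fin 5 := ![0, 1, 0, 0, 0, 0, 2, 3, 4, 0]

/-- The fold is injective on the live support of the reduced instance. -/
theorem sunTen.fold_injOn :
    ∀ x y, sunTen.reduced.SuppOutside sunTen.dead 0 1 8 x → sunTen.reduced.SuppOutside sunTen.dead 0 1 8 y →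
      sunTen.fold x = sunTen.fold y → x = y := by
  decide

/-- **C-026 for the ten-edge sun at every `p`**: a unicyclic graph with the marks in three branches —
outside every landed family — settled by four series steps, the pendant-mark step and the
five-vertex endpoint. -/
theorem C026At_sunTen (p : Fin 10 → ℝ) (hp : IsProb p) : sunTen.C026At p 0 1 2 :=
  MInst.C026_of_reduces_five (x := ((sunTen, p), ((0 : Fin 10), (1 : Fin 10), (2 : Fin 10)))) hp
    (sunTen_reduces p) sunTen.dead (sunTen.reducedWeight_dead p) sunTen.fold sunTen.fold_injOn

end MultiGraph

end PercRepro
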